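import Mathlib
import Literature.Computability.AlgebraicComplexity.StandardFamilies
import Literature.Computability.AlgebraicComplexity.HessianAtOrigin
import Literature.Computability.AlgebraicComplexity.MignonRessayreBound
import Summits.ValiantsHypothesis.ValiantsHypothesis.Theorems.RefutationDegreeBeyondHessianNsPointLemma

/-!
# The Mignon–Ressayre point is a smooth zero of the permanent (crux `BeyondHessianNs`)

Helper file for crux item stmt-ValiantsHypothesis-5641 (`RefutationDegree.BeyondHessianNs`),
stub `stub_mrPointSmooth` of the line `Sketch`.

Let `n = p + 3` and let `y₀ = mrPoint ℂ p` be the Mignon–Ressayre point (the all-ones `n × n`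
matrix with entry `(0,0)` replaced by `-(p + 2)`), a zero of `per_n`. We show that it is a
SMOOTH zero: some first partial derivative `∂_e per_n` does not vanish at `y₀`.

Proof: `per_n` is homogeneous of degree `n` (tree `perPoly_isHomogeneous`), so Euler's identity
in `hess0`/`linPart` form (tree `euler_transl`) gives
`hess0 (per_n(X + y₀)) *ᵥ y₀ = (n - 1) • linPart (per_n(X + y₀))`. If the linear part vanished,
then, since `hess0 (per_n(X + y₀)) = p! • mrHess` (tree `hess0_transl_mrPoint_perPoly`) and
`mrHess` has trivial kernel (tree `mrHess_mulVec_eq_zero_imp`), we would get `y₀ = 0`,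
contradicting `y₀ (0,0) = -(p + 2) ≠ 0` (tree `mrPoint_apply`). Hence some coordinate `e` of the
linear part is non-zero, and `linPart (per_n(X + y₀)) e = (∂_e per_n)(y₀)` (tree `linPart_apply`,
`pderiv_transl`, `constantCoeff_transl`).

References: T. Mignon, N. Ressayre, IMRN 2004, §3; J. M. Landsberg, *Geometry and Complexity
Theory* (2017), §6.4.6.
-/

noncomputable section

-- single-conjunct layout: Sub = Summit, duplicated namespace component intended
set_option linter.dupNamespace false

namespace Summit.ValiantsHypothesis.ValiantsHypothesis.Theorems.RefutationDegreeBeyondHessianNs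

open MvPolynomial Matrix
open Literature.Computability.AlgebraicComplexity

/-- **The registered stub `stub_mrPointSmooth`** (line `Sketch`, crux `BeyondHessianNs`): the
Mignon–Ressayre point `y₀ = mrPoint ℂ p` of `{per_{p+3} = 0}` is a smooth zero, i.e. some first
partial derivative `∂_e per_{p+3}` does not vanish at `y₀` (Euler's identity
`H y₀ = (n - 1) ∇per(y₀)` with `H = p! • mrHess` injective and `y₀ ≠ 0`; module docstring).
[folklore] -/
theorem stub_mrPointSmooth : ∀ p : ℕ, ∃ e : Fin (p + 3) × Fin (p + 3), MvPolynomial.eval (Literature.Computability.AlgebraicComplexity.mrPoint ℂ p) (MvPolynomial.pderiv e (Literature.Computability.AlgebraicComplexity.perPoly (Fin (p + 3)) ℂ)) ≠ 0 := by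
  intro p
  -- `per_{p+3}` is homogeneous of degree `p + 3`
  have hhom : (perPoly (Fin (p + 3)) ℂ).IsHomogeneous (p + 3) := by
    simpa [Fintype.card_fin] using (perPoly_isHomogeneous (n := Fin (p + 3)) (k := ℂ))
  -- Euler: `H y₀ = (n - 1) ∇per(y₀)`
  obtain ⟨hE1, -⟩ := euler_transl (perPoly (Fin (p + 3)) ℂ) hhom (mrPoint ℂ p)
  -- the gradient at `y₀` is non-zero since `H = p! • mrHess` is injective and `y₀ ≠ 0`
  have hlin : linPart (transl (mrPoint ℂ p) (perPoly (Fin (p + 3)) ℂ)) ≠ 0 := by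
    intro h0
    rw [h0, smul_zero, hess0_transl_mrPoint_perPoly, Matrix.smul_mulVec] at hE1
    have h1 : mrHess ℂ p *ᵥ mrPoint ℂ p = 0 :=
      (smul_eq_zero.mp hE1).resolve_left (by exact_mod_cast Nat.factorial_ne_zero p)
    have hy0 := congrFun (mrHess_mulVec_eq_zero_imp _ h1) ((0 : Fin (p + 3)), (0 : Fin (p + 3)))
    rw [mrPoint_apply, if_pos ⟨rfl, rfl⟩, Pi.zero_apply, neg_eq_zero] at hy0
    have hp2 : ((p : ℂ) + 2) ≠ 0 := by exact_mod_cast (Nat.succ_ne_zero _ : p + 2 ≠ 0)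
    exact hp2 hy0
  -- some coordinate of the gradient is non-zero: it is a first partial of `per` at `y₀`
  obtain ⟨e, he⟩ := Function.ne_iff.mp hlin
  rw [Pi.zero_apply, linPart_apply, pderiv_transl, constantCoeff_transl] at he
  exact ⟨e, he⟩

end Summit.ValiantsHypothesis.ValiantsHypothesis.Theorems.RefutationDegreeBeyondHessianNs

end
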